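import Mathlib
import Summits.ValiantsHypothesis.ValiantsHypothesis.Theorems.BarrierLeverPartitionMinorsHitByVPHiddenStatesSecondShellBlockedBottom

/-!
# Route BarrierLever — item `PartitionMinorsHitByVP` (stmt-ValiantsHypothesis-19717), line `hidden-states`:
# ★★ THE EQUAL-Y BLOCKED-LEVEL CELL OF THE SECOND SHELL (every `t, h`, `|C ∖ A| ≥ 4`)

Helper file (`--supports stmt-ValiantsHypothesis-19717`; cell valiant-natproofs, 𝒟-side door (c), registered line
`Cruxes/PartitionMinorsHitByVP/Lines/hidden_states.lean` v9; prover seat val-np-p6 gen 20).  Closes NO item; definition-free.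

THE CELL (memo HOME/val-np-p6/g20/MEMO-valnp6-g20.md §3, cell EQB of the eight-cell decomposition; the `|Y| ≥ 4` companion of gen 17's
cyclic `…SecondShellEqualY` cell for `|Y| = 3`).  Equal paths `C₁ ∖ A₁ = C₂ ∖ A₂ = Y` with `|Y| ≥ 4`, an attachment `z₀ ∈ (A₁∖C₁) ∩ A₂ ∩ C₂`
of swap 1 and an attachment `y₀ ∈ (A₂∖C₂) ∖ (A₁ ∪ C₁)` of swap 2.  ORIENTATION: both paths in the same (increasing) order, `z₀` and `y₀` at
the top attachment level `k − 2`.  For `D(A₁ ← C₂)` the top node is a SOURCE and the third node is BLOCKED (it reads the fourth node, the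
immobile token `z₀` and the dead coordinate `y₀`); the top only reads the second node, so the two forced colliders of
`…SecondShellForcedColliders.exists_active_of_source_of_blocked` cannot collide with each other and the master template serves the family:
★★ `exists_table_secondShell_equalBlocked`.

HONEST LABEL: conjecture-column cell (second shell, every `t, h`); 19717 stays OPEN; nothing on crux 14610 or VP ≠ VNP.
-/

set_option linter.dupNamespace false

namespace Summit.ValiantsHypothesis.ValiantsHypothesis.Theorems.BarrierLever.HiddenStates

open Finset

noncomputable section

namespace SecondShell

open PathTable

set_option maxHeartbeats 800000 in
/-- ★★ **SECOND SHELL, EQUAL PATHS WITH A BLOCKED LEVEL, EVERY `t, h`.**  `C₁ ∖ A₁ = C₂ ∖ A₂` of size `≥ 4`, `z₀ ∈ (A₁ ∖ C₁) ∩ A₂ ∩ C₂`,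
`y₀ ∈ (A₂ ∖ C₂) ∖ (A₁ ∪ C₁)` ⇒ the second-shell family `B_t(h) ∖ {A₁, A₂} ∪ {C₁, C₂}` is served. -/
theorem exists_table_secondShell_equalBlocked (h t : ℕ) (A₁ A₂ C₁ C₂ : Finset (Fin h))
    (hA₁ : A₁.card = t) (hA₂ : A₂.card = t) (hC₁ : C₁.card = t + 1) (hC₂ : C₂.card = t + 1)
    (h₁ : ¬ A₁ ⊆ C₁) (h₂ : ¬ A₂ ⊆ C₂) (hA : A₁ ≠ A₂) (hC : C₁ ≠ C₂)
    (hY : C₁ \ A₁ = C₂ \ A₂) (h4 : 4 ≤ (C₁ \ A₁).card)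
    {z₀ y₀ : Fin h} (hz₁ : z₀ ∈ A₁) (hz₂ : z₀ ∉ C₁) (hz₃ : z₀ ∈ A₂) (hz₄ : z₀ ∈ C₂)
    (hy₁ : y₀ ∉ A₁) (hy₂ : y₀ ∉ C₁) (hy₃ : y₀ ∈ A₂) (hy₄ : y₀ ∉ C₂)
    {r : ℕ} (u cols : Fin r → Finset (Fin h)) (hu : Function.Injective u)
    (hU : ∀ i, ((u i).card ≤ t ∧ u i ≠ A₁ ∧ u i ≠ A₂) ∨ u i = C₁ ∨ u i = C₂)
    (hcols : ∀ J : Finset (Fin h), J.card ≤ t → ∃ kk, cols kk = J) :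
    ∃ tx : Option (Fin h) → Fin h → ℂ,
      (Matrix.of fun i kk : Fin r => ∏ a ∈ u i, (tx none a + ∑ q ∈ cols kk, tx (some q) a)).det ≠ 0 := by
  classical
  obtain ⟨k, j₁, j₁', hk₁, hkj₁, a1, a2, a3, a4⟩ := swap_sizes A₁ C₁ hA₁ hC₁ h₁
  obtain ⟨k₂, j₂, j₂', hk₂, hkj₂, c1, c2, c3, c4⟩ := swap_sizes A₂ C₂ hA₂ hC₂ h₂
  obtain rfl : k = k₂ := by rw [← hY, a1] at c1; omega
  have hk3 : 3 ≤ k := by rw [a1] at h4; omega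
  -- one increasing enumeration of the common path, `z₀` / `y₀` at the top attachment level
  let κ : Fin h → ℕ := fun v => if v ∈ C₁ \ A₁ then (v : ℕ) + 1 else 0
  have hκY : ∀ v ∈ C₁ \ A₁, κ v = (v : ℕ) + 1 := fun v hv => by simp only [κ, if_pos hv]
  have hκinj : Set.InjOn κ ↑(C₁ \ A₁) := by
    intro v hv v' hv' hvv'
    rw [hκY v (Finset.mem_coe.1 hv), hκY v' (Finset.mem_coe.1 hv')] at hvv'; exact Fin.ext (by omega)
  obtain ⟨py, hinj, hmem, hmono⟩ := exists_keyed_enum (C₁ \ A₁) a1 κ hκinj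
  have hmem₂ : ∀ p, py p ∈ C₂ \ A₂ := fun p => hY ▸ hmem p
  obtain ⟨px₁, hpxi₁, hpxm₁, hpxz⟩ := exists_att_prescribed (A₁ \ C₁) a2 (Finset.mem_sdiff.2 ⟨hz₁, hz₂⟩) ⟨k - 1, by omega⟩
  obtain ⟨px₂, hpxi₂, hpxm₂, hpxy⟩ := exists_att_prescribed (A₂ \ C₂) c2 (Finset.mem_sdiff.2 ⟨hy₃, hy₄⟩) ⟨k - 1, by omega⟩
  obtain ⟨e₁, m1, m2, m3, m4, hpy₁, hpx₁⟩ := exists_equiv_prescribed A₁ C₁ a1 a2 a3 a4 py hinj hmem px₁ hpxi₁ hpxm₁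
  obtain ⟨e₂, n1, n2, n3, n4, hpy₂, hpx₂⟩ := exists_equiv_prescribed A₂ C₂ c1 c2 c3 c4 py hinj hmem₂ px₂ hpxi₂ hpxm₂
  -- the named nodes: top `u₁`, third `u₂`, fourth `u₃`
  set u₁ := py (Fin.last k) with hu₁def
  set u₂ := py ⟨k - 2, by omega⟩ with hu₂def
  set u₃ := py ⟨k - 3, by omega⟩ with hu₃def
  have htop₁ : e₁ (Sum.inl (Sum.inl (Fin.last k))) = u₁ := hpy₁ _
  have htop₂ : e₂ (Sum.inl (Sum.inl (Fin.last k))) = u₁ := hpy₂ _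
  have hne₁₂ : u₁ ≠ u₂ := fun h => by
    have := congrArg Fin.val (hinj h); simp [Fin.val_last] at this; omega
  have hne₂' : py ⟨k - 1, by omega⟩ ≠ u₂ := fun h => by
    have := congrArg Fin.val (hinj h); simp at this; omega
  have hne₃' : py ⟨k - 1, by omega⟩ ≠ u₃ := fun h => by
    have := congrArg Fin.val (hinj h); simp at this; omega
  have hu₁Y : u₁ ∈ C₁ \ A₁ := hmem _
  have hu₂Y : u₂ ∈ C₁ \ A₁ := hmem _
  have hu₁Y₂ : u₁ ∈ C₂ \ A₂ := hmem₂ _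
  have hu₂Y₂ : u₂ ∈ C₂ \ A₂ := hmem₂ _
  -- X-elements are off the path
  have hXY₁ : ∀ x ∈ A₁ \ C₁, x ∉ C₁ \ A₁ := fun x hx h' => by
    rw [Finset.mem_sdiff] at hx h'; exact h'.2 hx.1
  have hXY₂ : ∀ x ∈ A₂ \ C₂, x ∉ C₁ \ A₁ := fun x hx h' => by
    rw [hY] at h'; rw [Finset.mem_sdiff] at hx h'; exact h'.2 hx.1
  -- the potential
  have hdag : ∀ a v, a ≠ v → (swapTable' e₁ a v ≠ 0 ∨ swapTable' e₂ a v ≠ 0) → κ v < κ a := by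
    intro a v hav hE
    rcases hE with hE | hE
    · have ha : a ∈ C₁ \ A₁ := swapTable'_offdiag A₁ C₁ e₁ m1 hE (Ne.symm hav)
      obtain ⟨p, rfl⟩ := exists_pos_of_mem_Y e₁ m2 m3 m4 ha
      rcases swapTable'_out_of_path e₁ p hE (Ne.symm hav) with ⟨hp, rfl⟩ | ⟨i, -, rfl⟩
      · rw [hpy₁, hpy₁]
        exact hmono (Fin.lt_def.2 (Nat.sub_lt (by omega) Nat.one_pos))
      · have h0 : κ (e₁ (Sum.inl (Sum.inr i))) = 0 := by simp only [κ, if_neg (hXY₁ _ (m2 i))]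
        rw [h0, hκY _ ha]; omega
    · have ha : a ∈ C₂ \ A₂ := swapTable'_offdiag A₂ C₂ e₂ n1 hE (Ne.symm hav)
      obtain ⟨p, rfl⟩ := exists_pos_of_mem_Y e₂ n2 n3 n4 ha
      rcases swapTable'_out_of_path e₂ p hE (Ne.symm hav) with ⟨hp, rfl⟩ | ⟨i, -, rfl⟩
      · rw [hpy₂, hpy₂]
        exact hmono (Fin.lt_def.2 (Nat.sub_lt (by omega) Nat.one_pos))
      · have h0 : κ (e₂ (Sum.inl (Sum.inr i))) = 0 := by simp only [κ, if_neg (hXY₂ _ (n2 i))]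
        rw [h0, hκY _ (hY ▸ ha)]; omega
  -- the union digraph without its diagonal
  let E : Fin h → Fin h → Prop := fun a v => a ≠ v ∧ (swapTable' e₁ a v ≠ 0 ∨ swapTable' e₂ a v ≠ 0)
  -- the top is a source
  have hsrc : ∀ w, ¬ E w u₁ := by
    rintro w ⟨hne, hE | hE⟩
    · rw [← htop₁] at hE hne; exact hE (swapTable'_top_col A₁ C₁ e₁ m1 m2 m3 m4 hne)
    · rw [← htop₂] at hE hne; exact hE (swapTable'_top_col A₂ C₂ e₂ n1 n2 n3 n4 hne)
  -- the top reads only the second node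
  have htopout : ∀ v, E u₁ v → v = py ⟨k - 1, by omega⟩ := by
    rintro v ⟨hne, hE | hE⟩
    · rw [← htop₁] at hE hne; rw [← hpy₁]; exact swapTable'_top_row hk₁ e₁ hE (Ne.symm hne)
    · rw [← htop₂] at hE hne; rw [← hpy₂]; exact swapTable'_top_row hk₁ e₂ hE (Ne.symm hne)
  -- the third node reads the fourth node, `z₀` (table 1) and `y₀` (table 2)
  have hlvl : ∀ i : Fin k, lvlX k i = k - 2 → i = ⟨k - 1, by omega⟩ := by
    intro i hi; ext; simp only [lvlX] at hi; simp; omega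
  have hout : ∀ v, E u₂ v → v = u₃ ∨ v = z₀ ∨ v = y₀ := by
    rintro v ⟨hne, hE | hE⟩
    · rw [hu₂def, ← hpy₁] at hE hne
      rcases swapTable'_out_of_path e₁ _ hE (Ne.symm hne) with ⟨-, rfl⟩ | ⟨i, hi, rfl⟩
      · left; rw [hpy₁, hu₃def]; exact congrArg py (Fin.ext (by dsimp only; omega))
      · right; left; rw [hlvl i (by simpa using hi), hpx₁, hpxz]
    · rw [hu₂def, ← hpy₂] at hE hne
      rcases swapTable'_out_of_path e₂ _ hE (Ne.symm hne) with ⟨-, rfl⟩ | ⟨i, hi, rfl⟩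
      · left; rw [hpy₂, hu₃def]; exact congrArg py (Fin.ext (by dsimp only; omega))
      · right; right; rw [hlvl i (by simpa using hi), hpx₂, hpxy]
  -- `z₀` and `y₀` have no out-edge
  have hz₀out : ∀ w, ¬ E z₀ w := by
    rintro w ⟨hne, hE | hE⟩
    · rw [row_unit A₁ C₁ e₁ m1 (fun h' => (Finset.mem_sdiff.1 h').2 hz₁) w, if_neg (Ne.symm hne)] at hE; exact hE rfl
    · rw [row_unit A₂ C₂ e₂ n1 (fun h' => (Finset.mem_sdiff.1 h').2 hz₃) w, if_neg (Ne.symm hne)] at hE; exact hE rfl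
  have hy₀out : ∀ w, ¬ E y₀ w := by
    rintro w ⟨hne, hE | hE⟩
    · rw [row_unit A₁ C₁ e₁ m1 (fun h' => hy₂ (Finset.mem_sdiff.1 h').1) w, if_neg (Ne.symm hne)] at hE; exact hE rfl
    · rw [row_unit A₂ C₂ e₂ n1 (fun h' => (Finset.mem_sdiff.1 h').2 hy₃) w, if_neg (Ne.symm hne)] at hE; exact hE rfl
  have hu₁' := hu₁Y₂
  rw [Finset.mem_sdiff] at hu₁Y hu₂Y hu₁'
  -- the master template with the two forced colliders
  refine exists_table_secondShell_of_noReduced h t A₁ A₂ C₁ C₂ hA₁ hA₂ hC₁ hC₂ hA hC hk₁ hkj₁ hk₁ hkj₂ e₁ m1 m2 m3 m4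
    e₂ n1 n2 n3 n4 κ (fun a v hav hE => hdag a v hav hE) (Or.inl ?_) u cols hu hU hcols
  intro f g h0 hf hg h3 h4' h5 h6
  refine exists_active_of_source_of_blocked E C₂ A₁ hC₂ f g h0 (fun a ha hne => ⟨Ne.symm hne, hf a ha hne⟩)
    (fun a hne => ⟨Ne.symm hne, hg a hne⟩) h3 h4' h5 h6 hu₁'.1 hu₁Y.2 (Finset.mem_sdiff.1 hu₂Y₂).1 hu₂Y.2 hne₁₂ hsrc
    {u₃} (by simp) ?_ ?_ ?_
  · intro v hE
    rcases hout v hE with rfl | rfl | rfl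
    · exact Or.inl (Finset.mem_singleton_self _)
    · exact Or.inr (Or.inr ⟨hz₁, hz₄, hz₀out⟩)
    · exact Or.inr (Or.inl ⟨hy₁, hy₀out⟩)
  · intro hE; exact absurd (htopout _ hE) (Ne.symm hne₂')
  · intro v hv hE
    rw [Finset.mem_singleton] at hv
    exact hne₃' (hv ▸ (htopout _ hE)).symm

end SecondShell

end

end Summit.ValiantsHypothesis.ValiantsHypothesis.Theorems.BarrierLever.HiddenStates
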